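import Summits.ABC.IUTFork.Repair.RHQ3Sliver
import Summits.ABC.IUTFork.Repair.RHQ3SliverSum
import HarnessLib

/-!
# D-0079 RESCUE sub-cell R-H, ROUND 2 Q3 / MIN-SLICE (iv) WINDOW regime — the SLIVER LAW in kernel, part 3: the one-import bridge AT THE GENUINE DATUM
# `HBand (pilotDataOfK D K)` (= `InSigma8 D`) ⟹ `(l−3)·Σ_{p∈S} H_p·ln p < 4l·(Σ_{p∈S} ln p + #S·ln X)` and the SLIVER disjunction, for bad primes `S`

PROOF-ONLY (0 definitions). Composes, BY NAME, part 1 `RHQ3Sliver` (p481778: `localHeight_lt_of_hBand_pilotDataOfK` — «Σ₈ ⟹ locally log-Szpiro»,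
`(l−3)·(ord_v(q_v)/e(v|p)) < 4l·(1 + ⌊log_p e_w⌋)` at every bad place, input-free; `pow_log_ramIdx_le` — `p^{⌊log_p e_w⌋} ≤ e_w ≤ X`) with part 2
`RHQ3SliverSum` (p481796: `sliver_sum_lt`, `sliver`, `sliver_ratio` over an abstract finite set of primes). Seat abc-iut-rh-typ-2 gen 4 (Q3-typ lane,
rh-lead R13; rung LADDER-ABC:A2.RESCUE.H); abc-iut-rh-num-1 g2 2026-08-27T00:34:44Z / 01:12:38Z (GO) / 01:12:56Z (l-factor `l/(l−3)` concordant).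

THE DICTIONARY (hypothesis `hsel`, the reader's choice — exactly abc-iut-rh-num-1's table currency): a nonempty finite set `S` of rational primes and, over each
`p ∈ S`, ONE chosen bad place `w_p ∣ p` of `K` (under it `v_p` of `F`), with `H_p := ord_{v_p}(q_{v_p})/e(v_p|p)` (the local height; for a curve coming from
`ℚ` this is `ord_p` of the Tate parameter, the same at every `v ∣ p`), `T_p := ⌊log_p e_{w_p}⌋`, and a common bound `X ≥ e_{w_p}` (`X = [K:ℚ]` always works;
`X = E·l` on the tables, where `e_w = e_v·l`, `e_v ≤ E`). CONCLUSIONS: `sliver_sum_lt_pilotDataOfK` **(2) `(l−3)·Σ_{p∈S} H_p·ln p < 4l·(Σ_{p∈S} ln p + #S·ln X)`**;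
`sliver_pilotDataOfK` **the SLIVER DISJUNCTION at the datum: ∀ ν > e, `(l−3)·h_S < 4l·(R_S + ν·ln X)` ∨ `(l−3)·h_S < 4l·R_S·(1 + ln X/(ln ν − 1))`**
(`h_S = Σ_{p∈S} H_p ln p`, `R_S = Σ_{p∈S} ln p = ln rad_S`); `sliver_ratio_pilotDataOfK` (Szpiro-ratio form `ρ_S = h_S/R_S`). Taking `S` = ALL bad primes gives
abc-iut-rh-num-1's reading «a datum wholly in Σ₈ in [IUTchIV]'s window has Szpiro ratio ≤ 6 + ε(h, l), ε → 0» (numbers theirs: 6.35 at h = 2^140, E = 60;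
abc-iut-rh2-ref-3 6.346); any sub-family `S` of bad primes is allowed (the law is monotone in nothing — each place is bounded separately).
HONEST SCOPE: `HBand`/`InSigma8` is row 8's claim-tagged HYPOTHESIS (abc-iut-lens-strengthen-1 / abc-iut-rh-typ-8 / abc-iut-rh2-xi-2), never asserted; these
theorems say what it FORCES on the bad local heights of a genuine initial Θ-datum. The relation between `l` and `h` ([IUTchIV]'s window) and the value of `X`
are the reader's; nothing here asserts abc; TAKES NO SIDE on [IUTchIII] Cor. 3.12 or on any author.
[cite: Mochizuki2012, IUTchI Def. 3.1 (b)(c)(e) pp. 61–62, Ex. 3.2 (iv) p. 71; IUTchIV Prop. 1.2 (i)(ii) p. 10, Cor. 2.2 (ii) p. 46] [cite: DupuyHilado2025, §3.3–3.4]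
[claim: Mochizuki2012, status: disputed] for every IUT locution; the arithmetic is [folklore].
-/

noncomputable section

open Set Function NumberField IsDedekindDomain

namespace Summit.ABC.IUTFork.Repair.RH.Q3SliverGenuine

open Summit.ABC.IUTFork.Repair.RHHeightClass Summit.ABC.IUTFork.Repair.RH.Q3Sliver Summit.ABC.IUTFork.Repair.RH.Q3SliverSum
open Literature.IUT.LogThetaLattice Literature.IUT.LogVolume Literature.IUT.HodgeTheaters
open Summit.ABC.IUTFork.Thm311 Summit.ABC.IUTFork.Thm311.Real Summit.ABC.IUTFork.Cor312Prov

section Genuine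

variable {F K Fbar : Type} [Field F] [NumberField F] [Field K] [NumberField K] [Algebra F K] [Field Fbar]
  [Algebra F Fbar] [Algebra K Fbar] {E : WeierstrassCurve F} [E.IsElliptic] {l : ℕ} {Pb : BadPlacePredicates K}
  (D : InitialThetaData F K Fbar E l Pb)

/-- **(2) AT THE GENUINE DATUM: `HBand (pilotDataOfK D K)` ⟹ `(l−3)·Σ_{p∈S} H_p·ln p < 4l·(Σ_{p∈S} ln p + #S·ln X)`** for every nonempty finite set `S`
of primes each carrying a chosen bad place `w_p ∣ p` with `H_p = ord_{v_p}(q_{v_p})/e(v_p|p)`, `T_p = ⌊log_p e_{w_p}⌋`, `e_{w_p} ≤ X` (hypothesis `hsel`).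
`RHQ3Sliver.localHeight_lt_of_hBand_pilotDataOfK` + `pow_log_ramIdx_le` fed into `RHQ3SliverSum.sliver_sum_lt`. [cite: Mochizuki2012, IUTchI Def. 3.1 (e)
p. 62, Ex. 3.2 (iv) p. 71] [claim: Mochizuki2012, status: disputed] — `HBand` is a hypothesis; nothing asserted. -/
theorem sliver_sum_lt_pilotDataOfK (h : HBand (pilotDataOfK D K)) {S : Finset ℕ} (hS : ∀ p ∈ S, p.Prime) (hne : S.Nonempty)
    (H : ℕ → ℝ) (T : ℕ → ℕ) {X : ℝ}
    (hsel : ∀ (p : ℕ) (hp : p ∈ S), ∃ w : (thetaIndex (pilotDataOfK D K)).Fibre (.inr ⟨p, hS p hp⟩),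
      haveI : Fact p.Prime := ⟨hS p hp⟩
      placeOf (pilotDataOfK D K) p w ∈ (pilotDataOfK D K).S ∧
        H p = (qParamOrd E (finBelow F K (placeOf (pilotDataOfK D K) p w)) : ℝ) /
          (ramIdx F (finBelow F K (placeOf (pilotDataOfK D K) p w)) : ℝ) ∧
        T p = Nat.log p (ramIdx K (placeOf (pilotDataOfK D K) p w)) ∧
        (ramIdx K (placeOf (pilotDataOfK D K) p w) : ℝ) ≤ X) :
    ((l : ℝ) - 3) * ∑ p ∈ S, H p * Real.log p < 4 * (l : ℝ) * (∑ p ∈ S, Real.log p + (S.card : ℝ) * Real.log X) := by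
  refine sliver_sum_lt hS hne l H T (X := X) ?_ ?_
  · intro p hp
    obtain ⟨w, hw, -, hT, hXw⟩ := hsel p hp
    rw [hT]
    exact pow_log_ramIdx_le D ⟨p, hS p hp⟩ w hw hXw
  · intro p hp
    obtain ⟨w, hw, hH, hT, -⟩ := hsel p hp
    rw [hH, hT]
    exact localHeight_lt_of_hBand_pilotDataOfK D h ⟨p, hS p hp⟩ w hw

/-- **THE SLIVER DISJUNCTION AT THE GENUINE DATUM.** Under `HBand (pilotDataOfK D K)` and the dictionary `hsel` (with `X ≥ 1`), for every real `ν > e`: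
`(l−3)·h_S < 4l·(R_S + ν·ln X)` ∨ `(l−3)·h_S < 4l·R_S·(1 + ln X/(ln ν − 1))`, where `h_S = Σ_{p∈S} H_p·ln p`, `R_S = Σ_{p∈S} ln p` (`RHQ3SliverSum.sliver`).
READING (abc-iut-rh-num-1): with `S` = all bad primes, `X = E·l`, `ν = h^{1−η}` and `l` in [IUTchIV]'s window the binding second branch gives Szpiro ratio
`≤ 6 + ε(h, l)`, `ε → 0`. [cite: Mochizuki2012, IUTchIV Prop. 1.2 (i)(ii) p. 10, Cor. 2.2 (ii) p. 46] [claim: Mochizuki2012, status: disputed] — nothing asserted. -/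
theorem sliver_pilotDataOfK (h : HBand (pilotDataOfK D K)) {S : Finset ℕ} (hS : ∀ p ∈ S, p.Prime) (hne : S.Nonempty)
    (H : ℕ → ℝ) (T : ℕ → ℕ) {X : ℝ} (hX1 : 1 ≤ X)
    (hsel : ∀ (p : ℕ) (hp : p ∈ S), ∃ w : (thetaIndex (pilotDataOfK D K)).Fibre (.inr ⟨p, hS p hp⟩),
      haveI : Fact p.Prime := ⟨hS p hp⟩
      placeOf (pilotDataOfK D K) p w ∈ (pilotDataOfK D K).S ∧
        H p = (qParamOrd E (finBelow F K (placeOf (pilotDataOfK D K) p w)) : ℝ) /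
          (ramIdx F (finBelow F K (placeOf (pilotDataOfK D K) p w)) : ℝ) ∧
        T p = Nat.log p (ramIdx K (placeOf (pilotDataOfK D K) p w)) ∧
        (ramIdx K (placeOf (pilotDataOfK D K) p w) : ℝ) ≤ X)
    {ν : ℝ} (hν : Real.exp 1 < ν) :
    ((l : ℝ) - 3) * ∑ p ∈ S, H p * Real.log p < 4 * (l : ℝ) * (∑ p ∈ S, Real.log p + ν * Real.log X) ∨
    ((l : ℝ) - 3) * ∑ p ∈ S, H p * Real.log p <
      4 * (l : ℝ) * (∑ p ∈ S, Real.log p) * (1 + Real.log X / (Real.log ν - 1)) := by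
  refine sliver hS hne l H T hX1 (X := X) ?_ ?_ hν
  · intro p hp
    obtain ⟨w, hw, -, hT, hXw⟩ := hsel p hp
    rw [hT]
    exact pow_log_ramIdx_le D ⟨p, hS p hp⟩ w hw hXw
  · intro p hp
    obtain ⟨w, hw, hH, hT, -⟩ := hsel p hp
    rw [hH, hT]
    exact localHeight_lt_of_hBand_pilotDataOfK D h ⟨p, hS p hp⟩ w hw

/-- **Szpiro-ratio form at the genuine datum** (`ρ_S := h_S/R_S`): ∀ ν > e, `(l−3)·ρ_S < 4l·(1 + ν·ln X/R_S)` ∨ `(l−3)·ρ_S < 4l·(1 + ln X/(ln ν − 1))`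
(`RHQ3SliverSum.sliver_ratio`). [claim: Mochizuki2012, status: disputed] — `HBand` is a hypothesis; nothing asserted. -/
theorem sliver_ratio_pilotDataOfK (h : HBand (pilotDataOfK D K)) {S : Finset ℕ} (hS : ∀ p ∈ S, p.Prime) (hne : S.Nonempty)
    (H : ℕ → ℝ) (T : ℕ → ℕ) {X : ℝ} (hX1 : 1 ≤ X)
    (hsel : ∀ (p : ℕ) (hp : p ∈ S), ∃ w : (thetaIndex (pilotDataOfK D K)).Fibre (.inr ⟨p, hS p hp⟩),
      haveI : Fact p.Prime := ⟨hS p hp⟩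
      placeOf (pilotDataOfK D K) p w ∈ (pilotDataOfK D K).S ∧
        H p = (qParamOrd E (finBelow F K (placeOf (pilotDataOfK D K) p w)) : ℝ) /
          (ramIdx F (finBelow F K (placeOf (pilotDataOfK D K) p w)) : ℝ) ∧
        T p = Nat.log p (ramIdx K (placeOf (pilotDataOfK D K) p w)) ∧
        (ramIdx K (placeOf (pilotDataOfK D K) p w) : ℝ) ≤ X)
    {ν : ℝ} (hν : Real.exp 1 < ν) :
    ((l : ℝ) - 3) * ((∑ p ∈ S, H p * Real.log p) / ∑ p ∈ S, Real.log (p : ℝ)) <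
        4 * (l : ℝ) * (1 + ν * Real.log X / ∑ p ∈ S, Real.log (p : ℝ)) ∨
    ((l : ℝ) - 3) * ((∑ p ∈ S, H p * Real.log p) / ∑ p ∈ S, Real.log (p : ℝ)) <
        4 * (l : ℝ) * (1 + Real.log X / (Real.log ν - 1)) := by
  refine sliver_ratio hS hne l H T hX1 (X := X) ?_ ?_ hν
  · intro p hp
    obtain ⟨w, hw, -, hT, hXw⟩ := hsel p hp
    rw [hT]
    exact pow_log_ramIdx_le D ⟨p, hS p hp⟩ w hw hXw
  · intro p hp
    obtain ⟨w, hw, hH, hT, -⟩ := hsel p hp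
    rw [hH, hT]
    exact localHeight_lt_of_hBand_pilotDataOfK D h ⟨p, hS p hp⟩ w hw

/-- **The same from `InSigma8 D`** (abc-iut-rh2-xi-2's datum-class predicate): the SLIVER disjunction at the datum. [claim: Mochizuki2012, status: disputed] —
`InSigma8` is a hypothesis; nothing asserted. -/
theorem sliver_of_inSigma8 (h : InSigmaDatum.InSigma8 D) {S : Finset ℕ} (hS : ∀ p ∈ S, p.Prime) (hne : S.Nonempty)
    (H : ℕ → ℝ) (T : ℕ → ℕ) {X : ℝ} (hX1 : 1 ≤ X)
    (hsel : ∀ (p : ℕ) (hp : p ∈ S), ∃ w : (thetaIndex (pilotDataOfK D K)).Fibre (.inr ⟨p, hS p hp⟩),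
      haveI : Fact p.Prime := ⟨hS p hp⟩
      placeOf (pilotDataOfK D K) p w ∈ (pilotDataOfK D K).S ∧
        H p = (qParamOrd E (finBelow F K (placeOf (pilotDataOfK D K) p w)) : ℝ) /
          (ramIdx F (finBelow F K (placeOf (pilotDataOfK D K) p w)) : ℝ) ∧
        T p = Nat.log p (ramIdx K (placeOf (pilotDataOfK D K) p w)) ∧
        (ramIdx K (placeOf (pilotDataOfK D K) p w) : ℝ) ≤ X)
    {ν : ℝ} (hν : Real.exp 1 < ν) :
    ((l : ℝ) - 3) * ∑ p ∈ S, H p * Real.log p < 4 * (l : ℝ) * (∑ p ∈ S, Real.log p + ν * Real.log X) ∨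
    ((l : ℝ) - 3) * ∑ p ∈ S, H p * Real.log p <
      4 * (l : ℝ) * (∑ p ∈ S, Real.log p) * (1 + Real.log X / (Real.log ν - 1)) :=
  sliver_pilotDataOfK D ((InSigmaDatum.inSigma8_iff D).1 h) hS hne H T hX1 hsel hν

end Genuine

end Summit.ABC.IUTFork.Repair.RH.Q3SliverGenuine

end
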